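import Summits.BirchSwinnertonDyer.Rank1Residual.Additive.X3BranchGordEndStateIntrinsic
import Summits.BirchSwinnertonDyer.Rank1Residual.Additive.N10IsogenyTransport
import HarnessLib

/-!
# X3♯(G-ord, `e = 2`) at analytic rank `0`, anomalous rows included: `BSD(E,p)` for EVERY member of the
# isogeny class of a Case-1 member (Cassels transport of the intrinsic end states of
# `X3BranchGordEndStateIntrinsic.lean`) — cell `bsd-addord`, seat `bsd-addord-twist`

HONEST FRAMING (cell `bsd-addord`, `run/shared/lean/pub/bsd-addord/README.md` §4): the programme's
target of record is the full Birch–Swinnerton-Dyer formula for every `E/ℚ` of analytic rank `≤ 1`.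
THEOREMS ONLY (no `def`, no named fact, no `sorry`); nothing is booked by this file. The by-name
sentence for a NON-Case-1 member `W` of a booked class is one of the theorems below, fed with the
Case-1 member `W'` (its class binders + line datum / kernel record) and Cassels' isogeny invariance of
the BSD quotient (`hCassels : bsdRHS_eq_of_isIsogenous`, through `N10.bsdp_of_isIsogenous_of_bsdp`).

References: [MilneADT2006] Thm. I.7.3 (Cassels); [Miller2011LMS] Def. 1.1; the references of
`X3BranchGordEndStateIntrinsic.lean`.
-/

set_option autoImplicit false

noncomputable section

open scoped Classical

namespace Summit.BirchSwinnertonDyer.Rank1Residual.Additive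

open WeierstrassCurve NumberField IsDedekindDomain Field
  Literature.NumberTheory.EllipticCurves
  Literature.NumberTheory.EllipticCurves.ModularForms
  Literature.NumberTheory.EllipticCurves.GreenbergVatsal2000
  Literature.NumberTheory.EllipticCurves.Rank1Residual
  Literature.NumberTheory.EllipticCurves.Rank1Residual.Typed
  Literature.NumberTheory.GaloisRepresentations
  Summit.BirchSwinnertonDyer.Rank1Residual.AdditivePotMult
  Summit.BirchSwinnertonDyer.Rank1Residual.Additive.X3Branch

variable {W W' : WeierstrassCurve ℚ} [W.IsElliptic] [W.IsGloballyMinimal] [W'.IsElliptic]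
  [W'.IsGloballyMinimal] {p : ℕ} [hp : Fact p.Prime]

/-- **`BSD(E,p)`, `p ≥ 5`, for ANY member `W` of the class of a Case-1 member `W'` of X3♯(G-ord, `e = 2`)
∩ r0 — anomalous rows included** (Cassels ∘ `ClassX3Gord.bsdp_rankZero_of_facts_intrinsic` on `W'`).
[cite: MilneADT2006, Thm. I.7.3 and Remark I.7.4] [cite: Delbourgo1998, Prop. 4 (p. 144)]
[cite: GreenbergLNM1716, §3 Lemma 3.4 (p. 89)] [cite: Miller2011LMS, §1] -/
theorem ClassX3Gord.bsdp_of_isIsogenous_of_facts_intrinsic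
    (hCassels : bsdRHS_eq_of_isIsogenous)
    (hW16 : Wuthrich2014.thm16_halfEigenCharIdeal_dvd_cyclotomicPrime)
    (hGV : thm312_branch_unitContent_and_lambda_eq_residual_goodOrd)
    (h23 : datumSelmer_nonPrimitive_invariants)
    (h414 : Greenberg1999.prop414_noFiniteSubmodule_of_not_dvd_torsionOrder)
    (hGrK : Greenberg1999.imKummer_ge_strictCondition_goodOrdinary)
    (hLiftF : residualEpsilon_surjOn_of_lineRamifiedEven)
    (hDelG : Delbourgo1998.prop4_rankZero_constantCoeff_eq_unit_mul_of_potGoodOrd)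
    (hDel98 : Delbourgo1998.prop4_rankZero_pow_dvd_constantCoeff)
    (hGZK : rank_eq_analyticRank_of_analyticRank_le_one) (hmod : hasEntireLFunction_rat)
    (hmodD : nonempty_modularParametrizationData)
    (hiso : IsIsogenous W W')
    (hX' : ClassX3Gord W' p) (hp5 : 5 ≤ p) (he' : semistabilityIndex W' p = 2) (hr' : W'.analyticRank = 0)
    (Φ₀ : AddSubgroup (W'.geomTorsion (p : ℤ))) (hΦ : IsRationalLine W' p Φ₀)
    (hram0 : ¬ LineUnramifiedAt W' p Φ₀) (heven : LineEven W' p Φ₀)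
    (hram : ∀ (K : Type) [Field K] [NumberField K] [(galRange (K := ℚ) K).Normal],
      Module.finrank ℚ K = 2 → (∃ θ : K, θ ^ 2 = algebraMap ℚ K ((-1) ^ (p / 2) * p)) →
      ¬ ∀ v : HeightOneSpectrum (𝓞 ℚ), ((p : ℕ) : 𝓞 ℚ) ∈ v.asIdeal →
        ∀ 𝔓 ∈ v.primesAbove, ∀ σ ∈ 𝔓.inertia (absoluteGaloisGroup ℚ), ∀ P ∈ Φ₀,
          σ • P = (if σ ∈ galRange (K := ℚ) K then P else -P)) :
    BSDp W p := by
  have hr : W.analyticRank ≤ 1 := by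
    rw [analyticRank_eq_of_isIsogenous' hiso, hr']
    exact zero_le_one
  exact N10.bsdp_of_isIsogenous_of_bsdp p hCassels hGZK hmod hiso hr
    (ClassX3Gord.bsdp_rankZero_of_facts_intrinsic hW16 hGV h23 h414 hGrK hLiftF hDelG hDel98 hGZK hmod hmodD
      hX' hp5 he' hr' Φ₀ hΦ hram0 heven hram)

/-- **`BSD(E,3)` for ANY member `W` of the class of a Case-1 member `W'` of X3♯(G-ord, `e = 2`) ∩ r0 at
`p = 3` — anomalous rows included — from the kernel record `X3LineDatumThree W'`** (Cassels ∘
`ClassX3Gord.bsdp_three_rankZero_of_facts_of_lineDatum_intrinsic`).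
[cite: MilneADT2006, Thm. I.7.3 and Remark I.7.4] [cite: Delbourgo1998, Prop. 4 (p. 144)]
[cite: GreenbergLNM1716, §3 Lemma 3.4 (p. 89)] [cite: Miller2011LMS, §1] -/
theorem ClassX3Gord.bsdp_three_of_isIsogenous_of_facts_of_lineDatum_intrinsic [Fact (Nat.Prime 3)]
    (hCassels : bsdRHS_eq_of_isIsogenous)
    (hW16 : Wuthrich2014.thm16_halfEigenCharIdeal_dvd_cyclotomicPrime)
    (hGV : thm312_branch_unitContent_and_lambda_eq_residual_goodOrd)
    (h23 : datumSelmer_nonPrimitive_invariants)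
    (h414 : Greenberg1999.prop414_noFiniteSubmodule_of_not_dvd_torsionOrder)
    (hGrK : Greenberg1999.imKummer_ge_strictCondition_goodOrdinary)
    (hLiftE : residualEpsilon_surjOn_of_lineEven)
    (hDelG : Delbourgo1998.prop4_rankZero_constantCoeff_eq_unit_mul_of_potGoodOrd)
    (hDel98 : Delbourgo1998.prop4_rankZero_pow_dvd_constantCoeff)
    (hGZK : rank_eq_analyticRank_of_analyticRank_le_one) (hmod : hasEntireLFunction_rat)
    (hmodD : nonempty_modularParametrizationData)
    (hiso : IsIsogenous W W') (hX' : ClassX3Gord W' 3) (hr' : W'.analyticRank = 0)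
    (hL' : X3LineDatumThree W') : BSDp W 3 := by
  have hr : W.analyticRank ≤ 1 := by
    rw [analyticRank_eq_of_isIsogenous' hiso, hr']
    exact zero_le_one
  exact N10.bsdp_of_isIsogenous_of_bsdp 3 hCassels hGZK hmod hiso hr
    (ClassX3Gord.bsdp_three_rankZero_of_facts_of_lineDatum_intrinsic hW16 hGV h23 h414 hGrK hLiftE hDelG
      hDel98 hGZK hmod hmodD hX' hr' hL')

end Summit.BirchSwinnertonDyer.Rank1Residual.Additive

end
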